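import Literature.NumberTheory.EllipticCurves.ModularJacobianModTwoMultiplicityOne
import Literature.NumberTheory.EllipticCurves.NewformsHeckeProofs
import Literature.NumberTheory.EllipticCurves.ModularSymbolsLattice
import Mathlib.FieldTheory.Finiteness
import HarnessLib

/-!
# Route `ResidualThetaTransportAtTwo`, crux Kμ⁺ `SignedMuVanishingAtTwoPlus` (stmt-BirchSwinnertonDyer-20689), line
# `birth`, stub `stub_flatMuZeroAtTwo`: the (MO⁺) DICTIONARY, part 2 — the SOCLE COUNT «at most four classes mod `2Λ` of
# mod-2 eigenvectors in `Λ = H₁(X₀(N); ℤ)`» FROM the tree's named fact `buzzard2000_multiplicityOne_gamma0`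

Cell `bsd-wall`, width seat `bsd-wall-rtt-p4-w2` (g4). THEOREMS ONLY (no `def`, no `sorry`); the one named fact used
(`buzzard2000_multiplicityOne_gamma0`, Buzzard 2000 Prop. 2.4, typed in `Literature/…/ModularJacobianModTwoMultiplicityOne.lean`)
enters as an explicit hypothesis `hBuz`. Helper `--supports` the crux; closes nothing. BSD is not proved by this.

## What is proved (`card_le_four_of_multiplicityOne`)
Let `f ∈ S₂(Γ₀(N))`, `N` odd, be a normalised newform with INTEGER Hecke eigenvalues `A p` (`T_p f = (A p) f` at every
prime, `U_p` included), and let `Λ = periodHomology N ⊆ S₂(Γ₀(N))^∨` be the period homology with the dual Hecke action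
`t • φ = φ ∘ t` of `𝕋_ℤ = HeckeRing0 N 2`. Call `x ∈ Λ` a MOD-2 EIGENVECTOR if `T_p^∨ x − (A p) x ∈ 2Λ` for every prime `p`.
GRANTED `hBuz` and a Galois representation `ρ : G_ℚ → GL₂(k)` (`k` algebraically closed of characteristic `2`, discrete)
that is unramified at `p ∤ 2N` with `charpoly ρ(Frob_p) = X² − (A p) X + p`, irreducible, and non-scalar on a decomposition
group at `2` — Buzzard's hypotheses for the maximal ideal `𝔪_f = ker(𝕋_ℤ → 𝔽₂, t ↦ eigenvalue of t on f mod 2)` — every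
finite set of mod-2 eigenvectors that are pairwise incongruent mod `2Λ` has AT MOST `4` elements.
Proof: the eigenvalue character `ev : 𝕋_ℤ → ℤ` (`t f = ev(t) f`, by induction on `ℤ[T_p]`), `𝔪_f := ker(ev mod 2)` is
maximal with `𝕋_ℤ/𝔪_f ≅ 𝔽₂ ↪ k`; `hBuz` gives `dim_{𝕋/𝔪_f} J₀(N)[𝔪_f] = 2`, so `#J₀(N)[𝔪_f] = 4`; and
`x ↦ [½x] ∈ J₀(N) = S₂^∨/Λ` (`J0.divMap 2`) sends mod-2 eigenvectors INTO `J₀(N)[𝔪_f]` (every `t ∈ 𝔪_f` has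
`t^∨x ∈ ev(t)x + 2Λ = 2Λ`, again by induction on `ℤ[T_p]`) and is injective modulo `2Λ`.
This is the «dim Λ̄[𝔪_f] = 2» half of the dictionary (crux workfile `CuspSpanIhara.md` §3.6 (c)); the passage to CHARACTERS
(hypothesis (I) `hfour` of `…MultOneFlat.flatAtTwo_of_card_le_four`) is the Hecke-self-adjoint perfect pairing on `Λ` (part 3).

References: K. Buzzard, *On level-lowering for mod 2 representations*, Math. Res. Lett. 7 (2000) 95–110, Prop. 2.4, Def. 2.1–2.2
[Buzzard2000LevelLoweringModTwo]; H. Darmon, F. Diamond, R. Taylor, *Fermat's Last Theorem* §1.3, §4.1 [DarmonDiamondTaylor1995].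
-/

set_option autoImplicit false
set_option linter.dupNamespace false

noncomputable section

open scoped Classical MatrixGroups ModularForm NumberField

open CongruenceSubgroup Polynomial IsDedekindDomain Literature.NumberTheory.EllipticCurves
  Literature.NumberTheory.EllipticCurves.ModularForms Literature.NumberTheory.GaloisRepresentations Rat.HeightOneSpectrum

namespace Summit.BirchSwinnertonDyer.BirchSwinnertonDyer.Theorems.SignedMuAtTwo

namespace MultOneDictionary

variable {N : ℕ} [NeZero N]

/-- `t • (c • φ) = c • (t • φ)` for the dual Hecke action on `S₂(Γ₀(N))^∨` (`t^∨` is `ℂ`-linear; Darmon–Diamond–Taylor §1.3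
"act on `V` by duality"). [cite: DarmonDiamondTaylor1995, §1.3 (p. 32)] -/
theorem hecke_smul_complex_smul (t : HeckeRing0 N 2) (c : ℂ) (φ : Module.Dual ℂ (CuspForm (Gamma0 N) 2)) :
    t • (c • φ) = c • (t • φ) := by
  apply LinearMap.ext
  intro g
  simp [HeckeRing0.smul_dual_apply]

/-- **Eigen-data along `ℤ[T_p]`.** If `T_p f = (A p) f` for every prime `p` (integers `A p`) and `x ∈ S₂(Γ₀(N))^∨` has
`T_p^∨ x − (A p) x ∈ 2Λ` for all `p` (a mod-2 eigenvector when `x ∈ Λ`), then every `u ∈ 𝕋_ℤ = ℤ[T_p : p]` has an integer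
eigenvalue `n` on `f` with `u^∨ x − n x ∈ 2Λ` (induction on the subring generated by the `T_p`; `𝕋_ℤ` preserves `Λ`,
Darmon–Diamond–Taylor §1.6).
[cite: DarmonDiamondTaylor1995, §1.6 (p. 41)] -/
theorem exists_eigenvalue_and_sub_mem_two (f : CuspForm (Gamma0 N) 2) (A : ℕ → ℤ)
    (hA : ∀ (p : ℕ) (hp : p.Prime), (haveI : NeZero p := ⟨hp.ne_zero⟩; heckeT (Gamma0 N) 2 p) f = ((A p : ℤ) : ℂ) • f)
    {x : Module.Dual ℂ (CuspForm (Gamma0 N) 2)}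
    (hsoc : ∀ (p : ℕ) (hp : p.Prime), ∃ y ∈ periodHomology N,
      (haveI : NeZero p := ⟨hp.ne_zero⟩; heckeT (Gamma0 N) 2 p).dualMap x - ((A p : ℤ) : ℂ) • x = (2 : ℂ) • y)
    {u : Module.End ℂ (CuspForm (Gamma0 N) 2)} (hu : u ∈ heckeRing0 N 2) :
    ∃ n : ℤ, u f = (n : ℂ) • f ∧ ∃ y ∈ periodHomology N, u.dualMap x - (n : ℂ) • x = (2 : ℂ) • y := by
  change u ∈ Algebra.adjoin ℤ (heckeRing0Generators N 2) at hu
  induction hu using Algebra.adjoin_induction with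
  | mem u hu =>
    obtain ⟨p, hp, rfl⟩ := hu
    exact ⟨A p, hA p hp, hsoc p hp⟩
  | algebraMap r =>
    refine ⟨r, ?_, 0, (periodHomology N).zero_mem, ?_⟩
    · rw [Algebra.algebraMap_eq_smul_one, LinearMap.smul_apply, Module.End.one_apply, Int.cast_smul_eq_zsmul]
    · have : (algebraMap ℤ (Module.End ℂ (CuspForm (Gamma0 N) 2)) r).dualMap x = (r : ℂ) • x := by
        ext g
        rw [LinearMap.dualMap_apply, Algebra.algebraMap_eq_smul_one, LinearMap.smul_apply, Module.End.one_apply,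
          LinearMap.smul_apply, map_zsmul, Int.cast_smul_eq_zsmul]
      rw [this, sub_self, smul_zero]
  | add u w _ _ hu hw =>
    obtain ⟨m, hm, y, hy, hyu⟩ := hu
    obtain ⟨n, hn, z, hz, hzw⟩ := hw
    refine ⟨m + n, by rw [LinearMap.add_apply, hm, hn, Int.cast_add, add_smul], y + z, add_mem hy hz, ?_⟩
    have : (u + w).dualMap x = u.dualMap x + w.dualMap x := by
      ext g; simp only [LinearMap.dualMap_apply, LinearMap.add_apply, map_add]
    rw [this, Int.cast_add, add_smul, add_sub_add_comm, hyu, hzw, smul_add]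
  | mul u w _ hw' hu hw =>
    obtain ⟨m, hm, y, hy, hyu⟩ := hu
    obtain ⟨n, hn, z, hz, hzw⟩ := hw
    refine ⟨m * n, by rw [Module.End.mul_apply, hn, LinearMap.map_smul, hm, smul_smul, Int.cast_mul, mul_comm], ?_⟩
    -- (u w)^∨ x = w^∨ (u^∨ x) = w^∨ (m x + 2 y) = m (n x + 2 z) + 2 w^∨ y
    refine ⟨(m : ℂ) • z + w.dualMap y, add_mem ?_ (heckeRing0.dualMap_mem_periodHomology N hw' hy), ?_⟩
    · have hmz : (m : ℂ) • z = m • z := Int.cast_smul_eq_zsmul ℂ m z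
      rw [hmz]; exact (periodHomology N).zsmul_mem hz m
    have hcomp : (u * w).dualMap x = w.dualMap (u.dualMap x) := by
      ext g; simp only [LinearMap.dualMap_apply, Module.End.mul_apply]
    have hux : u.dualMap x = (m : ℂ) • x + (2 : ℂ) • y := by rw [← hyu]; abel
    have hwx : w.dualMap x = (n : ℂ) • x + (2 : ℂ) • z := by rw [← hzw]; abel
    rw [hcomp, hux, map_add, LinearMap.map_smul, LinearMap.map_smul, hwx, Int.cast_mul]
    simp only [smul_add, smul_smul]
    rw [mul_comm (m : ℂ) 2]
    abel

/-- **At most four classes of mod-2 eigenvectors, from mod-2 multiplicity one.** Let `N` be odd, `f ∈ S₂(Γ₀(N))` a normalised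
newform with integer Hecke eigenvalues `A p` (`cuspCoeff f p = A p` for all primes `p`), and GRANT Buzzard 2000 Prop. 2.4 in
the tree's typed form `hBuz : buzzard2000_multiplicityOne_gamma0` together with its hypotheses AT `𝔪_f`: a continuous
`ρ : G_ℚ → GL₂(k)` (`k` algebraically closed, `char k = 2`, discrete) unramified at the places `v ∤ 2N` with
`charpoly ρ(Frob_v) = X² − (A p_v) X + p_v`, irreducible, and with a non-scalar element in each decomposition group above `2`.
THEN every finite set `s ⊆ Λ = periodHomology N` of MOD-2 EIGENVECTORS (`T_p^∨ x − (A p) x ∈ 2Λ` for every prime `p`) that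
are pairwise INCONGRUENT mod `2Λ` has `s.card ≤ 4`. (The maximal ideal is `𝔪_f = ker(t ↦ ev_f(t) mod 2)`, `𝕋_ℤ/𝔪_f = 𝔽₂`;
`#J₀(N)[𝔪_f] = 2² ` by `hBuz`; `x ↦ [½x]` embeds the classes into `J₀(N)[𝔪_f]`.) No statement about any curve; BSD is not
proved by this. [cite: Buzzard2000LevelLoweringModTwo, Prop. 2.4 and Def. 2.1–2.2 (p. 100–101)]
[cite: DarmonDiamondTaylor1995, §1.3 (pp. 27–28, 32) and §4.1 (p. 107)] -/
theorem card_le_four_of_multiplicityOne (hBuz : buzzard2000_multiplicityOne_gamma0) (hN : Odd N)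
    (f : CuspForm (Gamma0 N) 2) (hf : IsNewform0 f) (A : ℕ → ℤ) (hA : ∀ p : ℕ, p.Prime → cuspCoeff f p = (A p : ℂ))
    (k : Type) [Field k] [IsAlgClosed k] [CharP k 2] [TopologicalSpace k] [DiscreteTopology k]
    (ρ : ModPGaloisRep ℚ k 2)
    (hρ : ∀ v : HeightOneSpectrum (𝓞 ℚ), ¬ ((primesEquiv v : Nat.Primes) : ℕ) ∣ 2 * N →
      ρ.IsUnramifiedAt v ∧
        ρ.HasFrobCharpolyAt v
          (X ^ 2 - C (((A ((primesEquiv v : Nat.Primes) : ℕ) : ℤ) : k)) * X + C (((primesEquiv v : Nat.Primes) : ℕ) : k)))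
    (hirr : FramedRep.IsIrreducible ρ)
    (h2 : ∀ v : HeightOneSpectrum (𝓞 ℚ), ((primesEquiv v : Nat.Primes) : ℕ) = 2 →
      ∀ 𝔓 ∈ v.primesAbove, ∃ σ ∈ 𝔓.decompositionSubgroup (Field.absoluteGaloisGroup ℚ),
        ∀ c : k, ((ρ σ : GL (Fin 2) k) : Matrix (Fin 2) (Fin 2) k) ≠ Matrix.scalar (Fin 2) c)
    (s : Finset (Module.Dual ℂ (CuspForm (Gamma0 N) 2)))
    (hs : ∀ x ∈ s, x ∈ periodHomology N ∧ ∀ (p : ℕ) (hp : p.Prime), ∃ y ∈ periodHomology N,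
      (haveI : NeZero p := ⟨hp.ne_zero⟩; heckeT (Gamma0 N) 2 p).dualMap x - ((A p : ℤ) : ℂ) • x = (2 : ℂ) • y)
    (hinc : ∀ x ∈ s, ∀ x' ∈ s, x ≠ x' → ¬ ∃ z ∈ periodHomology N, x - x' = (2 : ℂ) • z) :
    s.card ≤ 4 := by
  classical
  have hf0 : f ≠ 0 := hf.ne_zero
  have hAT : ∀ (p : ℕ) (hp : p.Prime), (haveI : NeZero p := ⟨hp.ne_zero⟩; heckeT (Gamma0 N) 2 p) f = ((A p : ℤ) : ℂ) • f := by
    intro p hp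
    haveI : NeZero p := ⟨hp.ne_zero⟩
    rw [IsNewform0.heckeT_eq_coeff_smul hf hp]
    change cuspCoeff f p • f = _
    rw [hA p hp]
  -- Step 1: the eigenvalue character `ev : 𝕋_ℤ → ℤ`
  have huniq : ∀ m n : ℤ, (m : ℂ) • f = (n : ℂ) • f → m = n := by
    intro m n h
    have h' : ((m : ℂ) - n) • f = 0 := by rw [sub_smul, h, sub_self]
    rcases smul_eq_zero.mp h' with h1 | h1
    · exact_mod_cast sub_eq_zero.mp h1
    · exact absurd h1 hf0
  have hex : ∀ t : HeckeRing0 N 2, ∃ n : ℤ, HeckeRing0.toEnd N 2 t f = (n : ℂ) • f := by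
    intro t
    obtain ⟨n, hn, -⟩ := exists_eigenvalue_and_sub_mem_two f A hAT (x := 0)
      (fun p hp ↦ ⟨0, (periodHomology N).zero_mem, by simp⟩) (HeckeRing0.toEnd_mem N 2 t)
    exact ⟨n, hn⟩
  choose ev hev using hex
  have hev_spec : ∀ (t : HeckeRing0 N 2) (n : ℤ), HeckeRing0.toEnd N 2 t f = (n : ℂ) • f → ev t = n :=
    fun t n hn ↦ huniq _ _ ((hev t).symm.trans hn)
  have hev1 : ev 1 = 1 := hev_spec 1 1 (by rw [map_one, Module.End.one_apply, Int.cast_one, one_smul])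
  have hevmul : ∀ t u : HeckeRing0 N 2, ev (t * u) = ev t * ev u := by
    intro t u
    apply hev_spec
    rw [map_mul, Module.End.mul_apply, hev u, LinearMap.map_smul, hev t, smul_smul, Int.cast_mul, mul_comm]
  have hevadd : ∀ t u : HeckeRing0 N 2, ev (t + u) = ev t + ev u := by
    intro t u
    apply hev_spec
    rw [map_add, LinearMap.add_apply, hev t, hev u, Int.cast_add, add_smul]
  have hev0 : ev 0 = 0 := hev_spec 0 0 (by rw [map_zero, LinearMap.zero_apply, Int.cast_zero, zero_smul])
  have hevT : ∀ (p : ℕ) (hp : p.Prime), ev (HeckeRing0.T N 2 p hp) = A p := by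
    intro p hp
    apply hev_spec
    rw [HeckeRing0.toEnd_T]
    exact hAT p hp
  let evHom : HeckeRing0 N 2 →+* ℤ :=
    { toFun := ev, map_one' := hev1, map_mul' := hevmul, map_zero' := hev0, map_add' := hevadd }
  -- Step 2: `𝔪_f = ker (ev mod 2)`, maximal, `𝕋/𝔪_f = 𝔽₂ ↪ k`
  let lam : HeckeRing0 N 2 →+* ZMod 2 := (Int.castRingHom (ZMod 2)).comp evHom
  have hlam : ∀ t, lam t = ((ev t : ℤ) : ZMod 2) := fun t ↦ rfl
  have hlam_surj : Function.Surjective lam := by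
    intro c
    fin_cases c
    · exact ⟨0, by rw [map_zero]; rfl⟩
    · exact ⟨1, by rw [map_one]; rfl⟩
  set 𝔪 : Ideal (HeckeRing0 N 2) := RingHom.ker lam with h𝔪def
  haveI h𝔪max : 𝔪.IsMaximal := RingHom.ker_isMaximal_of_surjective lam hlam_surj
  have h2mem : (2 : HeckeRing0 N 2) ∈ 𝔪 := by
    rw [h𝔪def, RingHom.mem_ker, map_ofNat]
    rfl
  have h2mem' : ((2 : ℕ) : HeckeRing0 N 2) ∈ 𝔪 := by rw [Nat.cast_ofNat]; exact h2mem
  let ι : HeckeRing0 N 2 ⧸ 𝔪 →+* k :=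
    Ideal.Quotient.lift 𝔪 ((ZMod.castHom (dvd_refl 2) k).comp lam) fun t ht ↦ by
      rw [h𝔪def, RingHom.mem_ker] at ht
      rw [RingHom.comp_apply, ht, map_zero]
  have hιT : ∀ (p : ℕ) (hp : p.Prime), ι (Ideal.Quotient.mk 𝔪 (HeckeRing0.T N 2 p hp)) = ((A p : ℤ) : k) := by
    intro p hp
    simp only [ι, Ideal.Quotient.lift_mk, RingHom.comp_apply, hlam, hevT p hp, ZMod.castHom_apply]
    exact ZMod.cast_intCast (dvd_refl 2) (A p)
  -- Step 3: Buzzard 2000 Prop. 2.4 at `𝔪_f`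
  have hdim : Module.finrank (HeckeRing0 N 2 ⧸ 𝔪) (Submodule.torsionBySet (HeckeRing0 N 2) (J0 N) 𝔪) = 2 := by
    refine hBuz N hN 𝔪 h𝔪max h2mem k ι ρ (fun v hv ↦ ?_) hirr h2
    obtain ⟨hur, hchar⟩ := hρ v hv
    refine ⟨hur, ?_⟩
    rw [hιT]
    exact hchar
  -- Step 4: `#J₀(N)[𝔪_f] = 4`
  letI : Field (HeckeRing0 N 2 ⧸ 𝔪) := Ideal.Quotient.field 𝔪
  haveI hfin : Finite (Submodule.torsionBySet (HeckeRing0 N 2) (J0 N) 𝔪) := J0.finite_torsionBySet N two_ne_zero h2mem'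
  haveI : Module.Finite (HeckeRing0 N 2 ⧸ 𝔪) (Submodule.torsionBySet (HeckeRing0 N 2) (J0 N) 𝔪) :=
    Module.Finite.of_finite
  have hcardK : Nat.card (HeckeRing0 N 2 ⧸ 𝔪) = 2 := by
    rw [h𝔪def, Nat.card_congr (RingHom.quotientKerEquivOfSurjective hlam_surj).toEquiv, Nat.card_zmod]
  have hcard4 : Nat.card (Submodule.torsionBySet (HeckeRing0 N 2) (J0 N) 𝔪) = 4 := by
    rw [Module.natCard_eq_pow_finrank (K := HeckeRing0 N 2 ⧸ 𝔪), hcardK, hdim]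
    norm_num
  -- Step 5: mod-2 eigenvectors land in `J₀(N)[𝔪_f]` under `x ↦ [½ x]`
  have hsmul_mem : ∀ x ∈ s, ∀ t ∈ 𝔪, ∃ w ∈ periodHomology N, t • x = (2 : ℂ) • w := by
    intro x hx t ht
    obtain ⟨hxΛ, hsoc⟩ := hs x hx
    obtain ⟨n, hn, y, hy, hyt⟩ := exists_eigenvalue_and_sub_mem_two f A hAT hsoc (HeckeRing0.toEnd_mem N 2 t)
    have hn' : ev t = n := hev_spec t n hn
    have h2n : (2 : ℤ) ∣ n := by
      rw [h𝔪def, RingHom.mem_ker, hlam, hn'] at ht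
      exact (ZMod.intCast_zmod_eq_zero_iff_dvd n 2).mp ht
    obtain ⟨m, rfl⟩ := h2n
    refine ⟨(m : ℂ) • x + y, add_mem ?_ hy, ?_⟩
    · rw [Int.cast_smul_eq_zsmul]; exact (periodHomology N).zsmul_mem hxΛ m
    · have htx : t • x = (HeckeRing0.toEnd N 2 t).dualMap x := rfl
      rw [htx, smul_add, smul_smul, ← hyt, Int.cast_mul, Int.cast_ofNat]
      abel
  have hmemT : ∀ x (hx : x ∈ s),
      J0.divMap N 2 ⟨x, (hs x hx).1⟩ ∈ Submodule.torsionBySet (HeckeRing0 N 2) (J0 N) 𝔪 := by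
    intro x hx
    rw [Submodule.mem_torsionBySet_iff]
    rintro ⟨t, ht⟩
    obtain ⟨w, hw, htw⟩ := hsmul_mem x hx t ht
    change t • Submodule.Quotient.mk ((2 : ℂ)⁻¹ • x) = (0 : J0 N)
    rw [← Submodule.Quotient.mk_smul, hecke_smul_complex_smul, htw, smul_smul, inv_mul_cancel₀ two_ne_zero, one_smul,
      Submodule.Quotient.mk_eq_zero]
    exact hw
  -- Step 6: the map `s → J₀(N)[𝔪_f]` is injective (classes are incongruent mod `2Λ`)
  let g : s → Submodule.torsionBySet (HeckeRing0 N 2) (J0 N) 𝔪 := fun x ↦ ⟨J0.divMap N 2 ⟨x.1, (hs x.1 x.2).1⟩, hmemT x.1 x.2⟩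
  have hg : Function.Injective g := by
    rintro ⟨x, hx⟩ ⟨x', hx'⟩ h
    have h' : J0.divMap N 2 ⟨x, (hs x hx).1⟩ = J0.divMap N 2 ⟨x', (hs x' hx').1⟩ := congrArg Subtype.val h
    change Submodule.Quotient.mk ((2 : ℂ)⁻¹ • x) = Submodule.Quotient.mk ((2 : ℂ)⁻¹ • x') at h'
    rw [Submodule.Quotient.eq, mem_periodHomologyHecke] at h'
    by_contra hne
    have hne' : x ≠ x' := fun e ↦ hne (Subtype.ext e)
    refine hinc x hx x' hx' hne' ⟨(2 : ℂ)⁻¹ • x - (2 : ℂ)⁻¹ • x', h', ?_⟩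
    rw [smul_sub, smul_smul, mul_inv_cancel₀ two_ne_zero, one_smul, smul_smul, mul_inv_cancel₀ two_ne_zero, one_smul]
  -- Step 7: count
  calc s.card = Nat.card s := (Nat.card_eq_finsetCard s).symm
    _ ≤ Nat.card (Submodule.torsionBySet (HeckeRing0 N 2) (J0 N) 𝔪) := Nat.card_le_card_of_injective g hg
    _ = 4 := hcard4

end MultOneDictionary

end Summit.BirchSwinnertonDyer.BirchSwinnertonDyer.Theorems.SignedMuAtTwo

end
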